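import Summits.Ventures.WeilGRH.ZetaFlatWindowSpectral
import Summits.Ventures.WeilGRH.FlatWindowAtoms
import HarnessLib

/-!
# rh-explicit (venture WeilGRH): A `ζ`-RUNG BOUNDS THE SPECTRAL MASS AT EVERY HEIGHT —
  the pole term of the modulated window, and `2a · μ{τ} ≤ budget(a, τ)` for every `ζ`-window measure

Cell `rh-explicit`, WEIL TRACK (structure seat weil-3, gen10).  The `ζ` twin of `FlatWindowAtoms.lean`
(there: `χ` mod `q ≠ 1`, no pole) at EVERY height `τ`, completing `ZetaGramAtoms.lean` (lattice heights
`πn/a` only).  The modulated flat window `u_θ = e^{iθx} χ_0` (`χ_0 = (2a)^{-1/2} 𝟙_{[-a,a]}`) is a window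
function smooth inside the window, so every measure `μ` representing Weil's form on the tests of `[-a, a]`
represents the window form on it (`WeilBochnerMeasureWindow.weilWindowForm_eq_integral`, gen4):
`P(u_θ) + 𝓔_a(u_θ) − M_a = ∫ ‖χ̂_0(½+i(t+θ))‖² dμ(t) ≥ 2a · μ{−θ}`.  New here is the POLE TERM of the
modulated window (it is what `ZetaGramAtoms` lacked off the lattice):

* `integral_chi_zero_mul_cexp`, `integral_modulated_chi_zero_mul_cosh` (the even polar moment EXACTLY:
  `∫ u_θ cosh(x/2) = (sinh(a/2)cos(aθ) + 2θ cosh(a/2)sin(aθ))/((¼+θ²)√(2a))`, real; the odd moment and the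
  exact pole form `[(s·co + 2θc·si)² − (c·si − 2θs·co)²]/(a(¼+θ²)²)` are `ZetaModulatedWindowPole.lean`);
* **`weilPoleForm_modulated_chi_zero_le`**: `P(u_θ) ≤ 4(sinh²(a/2) + sin²(aθ))/(a(¼+θ²))` — the pole does
  not see high zeros (`P ≤ 2|∫u cosh|²`, Cauchy–Schwarz, `cosh² − sinh² = 1`);
* `weilDirichletEnergy_modulated_chi_zero`, **`weilWindowForm_modulated_chi_zero`** (closed form of the
  whole `ζ` window form of `u_θ`), `weilWindowForm_modulated_le_budget` (its explicit upper bound);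
* **`modulatedZetaFlatWindow_le_of_weilPositivityOn`** (RH-free): `WeilPositivityOn a ⟹`
  `2Σ_{log n<2a}Λ(n)n^{-1/2}(1 − log n/(2a))cos(θ log n) + K₀ − ∫₀^∞ρ₀(t)(2(1 − cos θt) + cos(θt)min(t,2a)/a)dt ≤ P(u_θ)`
  — a `ζ`-rung bounds the smoothed prime sums twisted by `n^{iθ}` at every height; unconditional for
  `a ≤ 4023/5000` (`…_of_le_8046`; the RH version for every `a` is in `ZetaWindowAtomsRH.lean`);
* **`two_mul_mul_zetaAtom_le`** (exact) and **`two_mul_mul_zetaAtom_le_budget`** (RH-free): for every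
  `a > 0`, every positive `μ` representing Weil's form on the tests of `[-a, a]` and every `τ ∈ ℝ`,
  `2a·μ{τ} ≤ 4(sinh²(a/2) + sin²(aτ))/(a(¼+τ²)) − K₀ + [Re ψ(¼+iτ/2) − Re ψ(¼)] + 5/a + 2Σ_{log n<2a}Λ(n)n^{-1/2}(1 − log n/(2a))`;
* under RH (`μ = Σ_ρ m_ρ δ_γ`, every window): `2a · ord_{s=½+iτ} ζ(s) ≤` the same budget for every `a > 0`
  — the positivity form of the classical multiplicity bound `m(γ) ≤ (½+o(1)) log γ/log log γ`
  (Goldston–Gonek 2007), one window at a time; that corollary is `ZetaWindowAtomsRH.lean`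
  (it needs `ZetaGramAtoms.zetaZeroHeightMeasure_singleton_of_riemannHypothesis`).

No definitions, no named facts; RH-free.

## References

* H. Yoshida, *On Hermitian forms attached to zeta functions*, Adv. Stud. Pure Math. 21 (1992) 281–325,
  §5 (5.1)/(5.15) (polar coefficients at the lattice frequencies). [Yoshida1992]
* D. A. Goldston, S. M. Gonek, *A note on S(t) and the zeros of the Riemann zeta-function*, Bull. London
  Math. Soc. 39 (2007) 482–486. [GoldstonGonek2007]
-/

set_option autoImplicit false

noncomputable section

open Complex Filter Set MeasureTheory
open scoped Real Topology ComplexConjugate ArithmeticFunction.vonMangoldt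

namespace Summit.Ventures.WeilGRH

open Literature.NumberTheory.LFunctions
open Literature.NumberTheory.LFunctions.Yoshida1992 (chi chiCore)
open Literature.Analysis.SpecialFunctions (reDigammaQuarter)
open Summit.RiemannHypothesis.RiemannHypothesis.Theorems.WeilFormatC
open Summit.RiemannHypothesis.RiemannHypothesis.Theorems.WeilBochnerMeasure (weilWindowForm_eq_integral
  integrable_inv_one_add_sq)

variable {a : ℝ}

/-! ## The polar moments of the modulated flat window -/

/-- `∫ χ_0(x) e^{cx} dx = (2a)^{-1/2} (e^{ca} − e^{−ca})/c` for complex `c ≠ 0` (`a > 0`). -/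
theorem integral_chi_zero_mul_cexp (ha : 0 < a) {c : ℂ} (hc : c ≠ 0) :
    ∫ x, chi a 0 x * cexp (c * x) =
      ((1 / Real.sqrt (2 * a) : ℝ) : ℂ) * ((cexp (c * a) - cexp (-(c * a))) / c) := by
  rw [integral_chi_mul ha.le 0]
  have hfun : (fun x : ℝ ↦ ((1 / Real.sqrt (2 * a) : ℝ) : ℂ) * cexp (π * I * ((0 : ℤ) : ℂ) * x / a) *
      cexp (c * x)) = fun x : ℝ ↦ ((1 / Real.sqrt (2 * a) : ℝ) : ℂ) * cexp (c * x) := by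
    funext x
    simp only [Int.cast_zero, mul_zero, zero_mul, zero_div, Complex.exp_zero, mul_one]
  rw [hfun, intervalIntegral.integral_const_mul, integral_exp_mul_complex hc]
  congr 2
  push_cast
  ring_nf

/-- `e^{(σ+iθ)a} = e^{σa}(cos θa + i sin θa)` for real `σ, θ, a`. -/
theorem cexp_add_mul_I_mul_ofReal (σ θ a : ℝ) :
    cexp (((σ : ℂ) + θ * I) * a) =
      (Real.exp (σ * a) : ℂ) * ((Real.cos (θ * a) : ℂ) + (Real.sin (θ * a) : ℂ) * I) := by
  rw [show ((σ : ℂ) + θ * I) * a = ((σ * a : ℝ) : ℂ) + ((θ * a : ℝ) : ℂ) * I by push_cast; ring,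
    Complex.exp_add, Complex.exp_mul_I, Complex.ofReal_exp, Complex.ofReal_cos, Complex.ofReal_sin]

/-- `e^{−(σ+iθ)a} = e^{−σa}(cos θa − i sin θa)` for real `σ, θ, a`. -/
theorem cexp_neg_add_mul_I_mul_ofReal (σ θ a : ℝ) :
    cexp (-(((σ : ℂ) + θ * I) * a)) =
      (Real.exp (-(σ * a)) : ℂ) * ((Real.cos (θ * a) : ℂ) - (Real.sin (θ * a) : ℂ) * I) := by
  rw [show -(((σ : ℂ) + θ * I) * a) = (((-(σ * a) : ℝ)) : ℂ) + ((-(θ * a) : ℝ) : ℂ) * I by push_cast; ring,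
    Complex.exp_add, Complex.exp_mul_I, Complex.ofReal_exp, Complex.ofReal_cos, Complex.ofReal_sin]
  simp only [Complex.ofReal_neg, Complex.cos_neg, Complex.sin_neg]
  ring

/-- **The even polar moment of the modulated flat window** (`a > 0`, `θ ∈ ℝ`):
`∫ e^{iθx}χ_0(x) cosh(x/2) dx = (sinh(a/2)cos(θa) + 2θ cosh(a/2)sin(θa)) / ((¼+θ²)√(2a))` — a real number. -/
theorem integral_modulated_chi_zero_mul_cosh (ha : 0 < a) (θ : ℝ) :
    ∫ x, cexp (I * (θ * x : ℝ)) * chi a 0 x * (Real.cosh (x / 2) : ℂ) =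
      (((Real.sinh (a / 2) * Real.cos (θ * a) + 2 * θ * Real.cosh (a / 2) * Real.sin (θ * a)) /
        ((1 / 4 + θ ^ 2) * Real.sqrt (2 * a)) : ℝ) : ℂ) := by
  set cp : ℂ := (((1 / 2 : ℝ) : ℂ) + θ * I) with hcp
  set cm : ℂ := (((-(1 / 2) : ℝ) : ℂ) + θ * I) with hcm
  have hcp0 : cp ≠ 0 := by
    intro h; have := congrArg Complex.re h; simp [hcp] at this
  have hcm0 : cm ≠ 0 := by
    intro h; have := congrArg Complex.re h; simp [hcm] at this
  have hpt : (fun x : ℝ ↦ cexp (I * (θ * x : ℝ)) * chi a 0 x * (Real.cosh (x / 2) : ℂ)) =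
      fun x ↦ ((1 / 2 : ℝ) : ℂ) * (chi a 0 x * cexp (cp * x) + chi a 0 x * cexp (cm * x)) := by
    funext x
    have e1 : cexp (cp * x) = cexp (I * (θ * x : ℝ)) * cexp ((x : ℂ) / 2) := by
      rw [← Complex.exp_add]; congr 1; rw [hcp]; push_cast; ring
    have e2 : cexp (cm * x) = cexp (I * (θ * x : ℝ)) * cexp (-((x : ℂ) / 2)) := by
      rw [← Complex.exp_add]; congr 1; rw [hcm]; push_cast; ring
    rw [e1, e2, Complex.ofReal_cosh, Complex.cosh]
    push_cast
    ring
  rw [hpt, integral_const_mul, integral_add (integrable_chi_mul 0 (by fun_prop)) (integrable_chi_mul 0 (by fun_prop)),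
    integral_chi_zero_mul_cexp ha hcp0, integral_chi_zero_mul_cexp ha hcm0]
  rw [hcp, hcm, cexp_add_mul_I_mul_ofReal, cexp_neg_add_mul_I_mul_ofReal, cexp_add_mul_I_mul_ofReal,
    cexp_neg_add_mul_I_mul_ofReal]
  have e1 : (1 / 2 : ℝ) * a = a / 2 := by ring
  have e2 : (-(1 / 2) : ℝ) * a = -(a / 2) := by ring
  rw [e1, e2, neg_neg]
  rw [Real.sinh_eq, Real.cosh_eq]
  have h1 : (1 / 2 : ℝ) * (1 / 2) + θ * θ ≠ 0 := (by nlinarith [mul_self_nonneg θ] : (0 : ℝ) < _).ne'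
  have h2 : (-(1 / 2) : ℝ) * (-(1 / 2)) + θ * θ ≠ 0 := (by nlinarith [mul_self_nonneg θ] : (0 : ℝ) < _).ne'
  have h3 : Real.sqrt (2 * a) ≠ 0 := (Real.sqrt_pos.2 (by linarith)).ne'
  have h4 : (1 / 4 + θ ^ 2 : ℝ) ≠ 0 := by positivity
  apply Complex.ext
  · simp only [Complex.mul_re, Complex.add_re, Complex.sub_re, Complex.div_re, Complex.ofReal_re,
      Complex.ofReal_im, Complex.mul_im, Complex.add_im, Complex.sub_im, Complex.div_im, Complex.I_re,
      Complex.I_im, Complex.normSq_apply, mul_zero, zero_mul, sub_zero, add_zero, mul_one, zero_add]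
    field_simp
    ring
  · simp only [Complex.mul_re, Complex.add_re, Complex.sub_re, Complex.div_re, Complex.ofReal_re,
      Complex.ofReal_im, Complex.mul_im, Complex.add_im, Complex.sub_im, Complex.div_im, Complex.I_re,
      Complex.I_im, Complex.normSq_apply, mul_zero, zero_mul, sub_zero, add_zero, mul_one, zero_add]
    field_simp
    ring

/-! ## The pole term of the modulated window does not see high zeros -/

/-- **THE POLE TERM OF THE MODULATED WINDOW DECAYS IN THE HEIGHT**:
`P(e^{iθx}χ_0) ≤ 4(sinh²(a/2) + sin²(θa)) / (a(¼+θ²))` (`a > 0`, `θ ∈ ℝ`).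
(`P(u) = 2|∫u cosh(x/2)|² − 2|∫u sinh(x/2)|² ≤ 2|∫u cosh(x/2)|²`, the even moment in closed form, and
Cauchy–Schwarz `(s·co + 2θ·c·si)² ≤ (1 + 4θ²)(s²co² + c²si²) = (1+4θ²)(s² + si²)`, `c² − s² = 1`.)  The exact
value is `[(s co + 2θ c si)² − (c si − 2θ s co)²]/(a(¼+θ²)²)` (`s, c = sinh, cosh(a/2)`, `co, si = cos, sin(θa)`). -/
theorem weilPoleForm_modulated_chi_zero_le (ha : 0 < a) (θ : ℝ) :
    weilPoleForm (fun x ↦ cexp (I * (θ * x : ℝ)) * chi a 0 x) ≤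
      4 * (Real.sinh (a / 2) ^ 2 + Real.sin (θ * a) ^ 2) / (a * (1 / 4 + θ ^ 2)) := by
  unfold weilPoleForm
  rw [integral_modulated_chi_zero_mul_cosh ha θ, Complex.norm_real, Real.norm_eq_abs, sq_abs]
  set s := Real.sinh (a / 2) with hs
  set c := Real.cosh (a / 2) with hc
  set co := Real.cos (θ * a) with hco
  set si := Real.sin (θ * a) with hsi
  have hc2 : c ^ 2 = s ^ 2 + 1 := Real.cosh_sq (a / 2)
  have hcs : co ^ 2 + si ^ 2 = 1 := Real.cos_sq_add_sin_sq (θ * a)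
  have hq : 0 < 1 / 4 + θ ^ 2 := by positivity
  have h2a : Real.sqrt (2 * a) ^ 2 = 2 * a := Real.sq_sqrt (by linarith)
  have key : (s * co + 2 * θ * c * si) ^ 2 ≤ (1 + 4 * θ ^ 2) * (s ^ 2 + si ^ 2) := by
    have h1 : (1 + 4 * θ ^ 2) * (s ^ 2 * co ^ 2 + c ^ 2 * si ^ 2) - (s * co + 2 * θ * c * si) ^ 2 =
        (2 * θ * s * co - c * si) ^ 2 := by ring
    have h2 : s ^ 2 * co ^ 2 + c ^ 2 * si ^ 2 = s ^ 2 + si ^ 2 := by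
      rw [hc2]
      calc s ^ 2 * co ^ 2 + (s ^ 2 + 1) * si ^ 2 = s ^ 2 * (co ^ 2 + si ^ 2) + si ^ 2 := by ring
        _ = s ^ 2 + si ^ 2 := by rw [hcs]; ring
    nlinarith [sq_nonneg (2 * θ * s * co - c * si)]
  have hsinh : 0 ≤ 2 * ‖∫ x, cexp (I * (θ * x : ℝ)) * chi a 0 x * (Real.sinh (x / 2) : ℂ)‖ ^ 2 := by positivity
  calc 2 * ((s * co + 2 * θ * c * si) / ((1 / 4 + θ ^ 2) * Real.sqrt (2 * a))) ^ 2 -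
        2 * ‖∫ x, cexp (I * (θ * x : ℝ)) * chi a 0 x * (Real.sinh (x / 2) : ℂ)‖ ^ 2
      ≤ 2 * ((s * co + 2 * θ * c * si) / ((1 / 4 + θ ^ 2) * Real.sqrt (2 * a))) ^ 2 := by linarith
    _ = (s * co + 2 * θ * c * si) ^ 2 / (a * (1 / 4 + θ ^ 2) ^ 2) := by
        rw [div_pow, mul_pow, h2a]; field_simp
    _ ≤ (1 + 4 * θ ^ 2) * (s ^ 2 + si ^ 2) / (a * (1 / 4 + θ ^ 2) ^ 2) :=
        div_le_div_of_nonneg_right key (by positivity)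
    _ = 4 * (s ^ 2 + si ^ 2) / (a * (1 / 4 + θ ^ 2)) := by
        field_simp

/-! ## The `ζ` window form of the modulated flat window, in closed form -/

/-- **The `ζ` Dirichlet energy of the modulated flat window**:
`𝓔_a(e^{iθx}χ_0) = Σ_{log n<2a} Λ(n)n^{-1/2}(2(1 − cos(θ log n)) + cos(θ log n)(log n)/a)`
`+ ∫₀^∞ ρ(t)(2(1 − cos θt) + cos(θt) min(t,2a)/a) dt`. -/
theorem weilDirichletEnergy_modulated_chi_zero (ha : 0 < a) (θ : ℝ) :
    weilDirichletEnergy a (fun x ↦ cexp (I * (θ * x : ℝ)) * chi a 0 x) =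
      (∑ n ∈ weilPrimeIndex a, (Λ n : ℝ) / Real.sqrt n *
          (2 * (1 - Real.cos (θ * Real.log n)) + Real.cos (θ * Real.log n) * (Real.log n / a))) +
        ∫ t in Ioi (0 : ℝ), weilArchDensity t *
          (2 * (1 - Real.cos (θ * t)) + Real.cos (θ * t) * (min t (2 * a) / a)) := by
  unfold weilDirichletEnergy
  congr 1
  · refine Finset.sum_congr rfl fun n hn ↦ ?_
    have hlog : Real.log n < 2 * a := mem_weilPrimeIndex.1 hn
    rw [weilIncrement_modulated_chi_zero ha θ (Real.log_natCast_nonneg n), min_eq_left hlog.le]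
  · exact setIntegral_congr_fun measurableSet_Ioi fun t (ht : 0 < t) ↦ by
      simp only [weilIncrement_modulated_chi_zero ha θ ht.le]

/-- **THE `ζ` WINDOW FORM OF THE MODULATED FLAT WINDOW** (`a > 0`, `θ ∈ ℝ`; `K₀ = log 4π + γ + 2∫₀^∞(e^{t/2}−1)dt/(2 sinh t)`):

  `weilWindowForm a (e^{iθx}χ_0) = P(e^{iθx}χ_0) − [2Σ_{log n<2a} Λ(n)n^{-1/2}(1 − log n/(2a)) cos(θ log n) + K₀`
      `− ∫₀^∞ ρ(t)(2(1 − cos θt) + cos(θt) min(t,2a)/a) dt]`. -/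
theorem weilWindowForm_modulated_chi_zero (ha : 0 < a) (θ : ℝ) :
    weilWindowForm a (fun x ↦ cexp (I * (θ * x : ℝ)) * chi a 0 x) =
      weilPoleForm (fun x ↦ cexp (I * (θ * x : ℝ)) * chi a 0 x) -
        (2 * (∑ n ∈ weilPrimeIndex a, (Λ n : ℝ) / Real.sqrt n *
              ((1 - Real.log n / (2 * a)) * Real.cos (θ * Real.log n))) +
          (Real.log (4 * π) + Real.eulerMascheroniConstant +
            2 * ∫ t in Ioi (0 : ℝ), (Real.exp (t / 2) - 1) / (2 * Real.sinh t)) -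
          ∫ t in Ioi (0 : ℝ), weilArchDensity t *
            (2 * (1 - Real.cos (θ * t)) + Real.cos (θ * t) * (min t (2 * a) / a))) := by
  rw [weilWindowForm, weilDirichletEnergy_modulated_chi_zero ha, integral_norm_sq_modulated_chi_zero ha, mul_one]
  unfold weilMarkovConstant
  have hsum : (∑ n ∈ weilPrimeIndex a, (Λ n : ℝ) / Real.sqrt n *
        (2 * (1 - Real.cos (θ * Real.log n)) + Real.cos (θ * Real.log n) * (Real.log n / a))) -
      2 * ∑ n ∈ weilPrimeIndex a, (Λ n : ℝ) / Real.sqrt n =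
      -(2 * ∑ n ∈ weilPrimeIndex a, (Λ n : ℝ) / Real.sqrt n *
          ((1 - Real.log n / (2 * a)) * Real.cos (θ * Real.log n))) := by
    rw [Finset.mul_sum, Finset.mul_sum, ← Finset.sum_sub_distrib, ← Finset.sum_neg_distrib]
    refine Finset.sum_congr rfl fun n _ ↦ ?_
    field_simp
    ring
  linarith [hsum]

/-- **The archimedean cost of modulation (parity `0`)**:
`∫₀^∞ ρ(t)(2(1 − cos τt) + cos(τt) min(t,2a)/a) dt ≤ [Re ψ(¼+iτ/2) − Re ψ(¼)] + 5/a`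
(`FlatWindowAtoms.integral_modulationCost_le` at `κ = 0`). -/
theorem integral_modulationCost_zero_le (ha : 0 < a) (τ : ℝ) :
    ∫ t in Ioi (0 : ℝ), weilArchDensity t *
        (2 * (1 - Real.cos (τ * t)) + Real.cos (τ * t) * (min t (2 * a) / a)) ≤
      (reDigammaQuarter τ - reDigammaQuarter 0) + 5 / a := by
  have h := integral_modulationCost_le 0 ha τ
  simp_rw [weilArchDensityPar_zero_apply] at h
  exact h

/-- The cosine-twisted flat sum is at least minus the flat sum: `|cos| ≤ 1`, weights `≥ 0` below the horizon. -/
theorem neg_flatSum_le_cos_flatSum (ha : 0 < a) (τ : ℝ) :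
    -(∑ n ∈ weilPrimeIndex a, (Λ n : ℝ) / Real.sqrt n * (1 - Real.log n / (2 * a))) ≤
      ∑ n ∈ weilPrimeIndex a, (Λ n : ℝ) / Real.sqrt n *
        ((1 - Real.log n / (2 * a)) * Real.cos (τ * Real.log n)) := by
  rw [← Finset.sum_neg_distrib]
  refine Finset.sum_le_sum fun n hn ↦ ?_
  have hlog : Real.log n < 2 * a := mem_weilPrimeIndex.1 hn
  have hw : 0 ≤ 1 - Real.log n / (2 * a) := by
    rw [sub_nonneg, div_le_one (by linarith)]; exact hlog.le
  have hΛ : 0 ≤ (Λ n : ℝ) / Real.sqrt n := div_nonneg ArithmeticFunction.vonMangoldt_nonneg (Real.sqrt_nonneg _)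
  have hre : -1 ≤ Real.cos (τ * Real.log n) := Real.neg_one_le_cos _
  have : -((Λ n : ℝ) / Real.sqrt n * (1 - Real.log n / (2 * a))) =
      (Λ n : ℝ) / Real.sqrt n * ((1 - Real.log n / (2 * a)) * (-1)) := by ring
  rw [this]
  exact mul_le_mul_of_nonneg_left (mul_le_mul_of_nonneg_left hre hw) hΛ

/-! ## The modulated `ζ` flat-window inequality (RH-free) -/

/-- **THE MODULATED `ζ` FLAT-WINDOW INEQUALITY — a `ζ`-rung bounds every height-twisted smoothed prime
sum below its horizon.**  For `a > 0` and every `θ ∈ ℝ`: if `WeilPositivityOn a`, then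

  `2Σ_{log n<2a} Λ(n)n^{-1/2}(1 − log n/(2a)) cos(θ log n) + K₀ − ∫₀^∞ ρ(t)(2(1 − cos θt) + cos(θt) min(t,2a)/a) dt`
    `≤ P(e^{iθx}χ_0)`

(at `θ = 0`: `ZetaFlatTest.zetaFlatWindow_le_of_weilPositivityOn`).  RH-free. -/
theorem modulatedZetaFlatWindow_le_of_weilPositivityOn (ha : 0 < a) (hW : WeilPositivityOn a) (θ : ℝ) :
    2 * (∑ n ∈ weilPrimeIndex a, (Λ n : ℝ) / Real.sqrt n *
          ((1 - Real.log n / (2 * a)) * Real.cos (θ * Real.log n))) +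
        (Real.log (4 * π) + Real.eulerMascheroniConstant +
          2 * ∫ t in Ioi (0 : ℝ), (Real.exp (t / 2) - 1) / (2 * Real.sinh t)) -
        ∫ t in Ioi (0 : ℝ), weilArchDensity t *
          (2 * (1 - Real.cos (θ * t)) + Real.cos (θ * t) * (min t (2 * a) / a)) ≤
      weilPoleForm (fun x ↦ cexp (I * (θ * x : ℝ)) * chi a 0 x) := by
  obtain ⟨hf, huf⟩ := modulated_chi_zero_smooth_inside a θ
  have h := weilWindowForm_nonneg_of_weilPositivityOn ha hW (isWindowFunction_modulated_chi_zero ha θ) hf huf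
  rw [weilWindowForm_modulated_chi_zero ha] at h
  linarith

/-- **Budget form, RH-free**: `WeilPositivityOn a ⟹` for every `θ`,
`2Σ_{log n<2a} Λ(n)n^{-1/2}(1 − log n/(2a)) cos(θ log n) ≤ 4(sinh²(a/2) + sin²(θa))/(a(¼+θ²)) − K₀ + [Re ψ(¼+iθ/2) − Re ψ(¼)] + 5/a`:
the pole term decays like `θ⁻²`, the archimedean weight grows like `log|θ|`. -/
theorem cos_flatSum_le_budget_of_weilPositivityOn (ha : 0 < a) (hW : WeilPositivityOn a) (θ : ℝ) :
    2 * (∑ n ∈ weilPrimeIndex a, (Λ n : ℝ) / Real.sqrt n *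
          ((1 - Real.log n / (2 * a)) * Real.cos (θ * Real.log n))) ≤
      4 * (Real.sinh (a / 2) ^ 2 + Real.sin (θ * a) ^ 2) / (a * (1 / 4 + θ ^ 2)) -
        (Real.log (4 * π) + Real.eulerMascheroniConstant +
          2 * ∫ t in Ioi (0 : ℝ), (Real.exp (t / 2) - 1) / (2 * Real.sinh t)) +
        (reDigammaQuarter θ - reDigammaQuarter 0) + 5 / a := by
  have h := modulatedZetaFlatWindow_le_of_weilPositivityOn ha hW θ
  have hP := weilPoleForm_modulated_chi_zero_le ha θ
  have hc := integral_modulationCost_zero_le ha θ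
  linarith

/-- **Unconditionally at the frontier rung and below** (`0 < a ≤ 4023/5000`,
`EvenWinsBeyondArch.weilPositivityOn_8046`): the modulated `ζ` flat-window inequality at every height. -/
theorem modulatedZetaFlatWindow_le_of_le_8046 (ha : 0 < a) (ha' : a ≤ 4023 / 5000) (θ : ℝ) :
    2 * (∑ n ∈ weilPrimeIndex a, (Λ n : ℝ) / Real.sqrt n *
          ((1 - Real.log n / (2 * a)) * Real.cos (θ * Real.log n))) +
        (Real.log (4 * π) + Real.eulerMascheroniConstant +
          2 * ∫ t in Ioi (0 : ℝ), (Real.exp (t / 2) - 1) / (2 * Real.sinh t)) -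
        ∫ t in Ioi (0 : ℝ), weilArchDensity t *
          (2 * (1 - Real.cos (θ * t)) + Real.cos (θ * t) * (min t (2 * a) / a)) ≤
      weilPoleForm (fun x ↦ cexp (I * (θ * x : ℝ)) * chi a 0 x) :=
  modulatedZetaFlatWindow_le_of_weilPositivityOn ha
    (Summit.RiemannHypothesis.RiemannHypothesis.Theorems.EvenWinsBeyondArch.weilPositivityOn_8046.mono ha') θ

/-! ## One `ζ`-rung bounds the spectral mass at every height (measure level, RH-free) -/

/-- **ONE `ζ`-RUNG BOUNDS THE SPECTRAL MASS AT EVERY HEIGHT (exact form).**  Let `a > 0` and let `μ`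
represent Weil's form on the tests of `[-a, a]`.  Then for every `τ ∈ ℝ`

  `2a·μ{τ} ≤ P(e^{−iτx}χ_0) − 2Σ_{log n<2a} Λ(n)n^{-1/2}(1 − log n/(2a)) cos(τ log n) − K₀`
            `+ ∫₀^∞ ρ(t)(2(1 − cos τt) + cos(τt) min(t,2a)/a) dt`

(the window form of the modulated window `e^{−iτx}χ_0` is `∫ 2sin²(a(t−τ))/(a(t−τ)²) dμ(t)` by
`weilWindowForm_eq_integral`, and the Fejér kernel centred at `τ` weighs the atom at `τ` by `2a`). -/
theorem two_mul_mul_zetaAtom_le (ha : 0 < a) {μ : Measure ℝ}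
    (hμ : ∀ g : ℝ → ℂ, IsWeilTest g → tsupport g ⊆ Icc (-a) a →
      Integrable (fun t : ℝ ↦ ‖weilMellin g (1 / 2 + t * I)‖ ^ 2) μ ∧
        weilQuadratic g = ((∫ t, ‖weilMellin g (1 / 2 + t * I)‖ ^ 2 ∂μ : ℝ) : ℂ)) (τ : ℝ) :
    2 * a * μ.real {τ} ≤
      weilPoleForm (fun x ↦ cexp (I * ((-τ) * x : ℝ)) * chi a 0 x) -
        2 * (∑ n ∈ weilPrimeIndex a, (Λ n : ℝ) / Real.sqrt n *
          ((1 - Real.log n / (2 * a)) * Real.cos (τ * Real.log n))) -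
        (Real.log (4 * π) + Real.eulerMascheroniConstant +
          2 * ∫ t in Ioi (0 : ℝ), (Real.exp (t / 2) - 1) / (2 * Real.sinh t)) +
        ∫ t in Ioi (0 : ℝ), weilArchDensity t *
          (2 * (1 - Real.cos (τ * t)) + Real.cos (τ * t) * (min t (2 * a) / a)) := by
  obtain ⟨hf, huf⟩ := modulated_chi_zero_smooth_inside a (-τ)
  obtain ⟨hint, heq⟩ := weilWindowForm_eq_integral ha hμ (isWindowFunction_modulated_chi_zero ha (-τ)) hf huf
  rw [weilWindowForm_modulated_chi_zero ha] at heq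
  have hcos : ∀ t : ℝ, Real.cos (-τ * t) = Real.cos (τ * t) := fun t ↦ by rw [neg_mul, Real.cos_neg]
  simp only [hcos] at heq
  -- the Fejér integral dominates the atom at `τ`
  set u : ℝ → ℂ := fun x ↦ cexp (I * ((-τ) * x : ℝ)) * chi a 0 x with hu
  have hI := integrable_inv_one_add_sq ha hμ
  have h0 := measure_singleton_lt_top_of_integrable hI τ
  have hind : Integrable (fun t : ℝ ↦ ({τ} : Set ℝ).indicator (fun _ ↦ 2 * a) t) μ :=
    (integrable_indicator_iff (measurableSet_singleton τ)).2 (integrableOn_const h0.ne)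
  have hle : ∀ t : ℝ, ({τ} : Set ℝ).indicator (fun _ ↦ 2 * a) t ≤ ‖weilMellin u (1 / 2 + t * I)‖ ^ 2 := by
    intro t
    by_cases ht : t ∈ ({τ} : Set ℝ)
    · rw [indicator_of_mem ht, mem_singleton_iff.1 ht, hu, norm_sq_weilMellin_modulated_chi_zero_self ha]
    · rw [indicator_of_notMem ht]; positivity
  have hatom : 2 * a * μ.real {τ} ≤ ∫ t, ‖weilMellin u (1 / 2 + t * I)‖ ^ 2 ∂μ := by
    calc 2 * a * μ.real {τ} = ∫ t, ({τ} : Set ℝ).indicator (fun _ ↦ 2 * a) t ∂μ := by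
          rw [integral_indicator_const _ (measurableSet_singleton τ), smul_eq_mul, mul_comm]
      _ ≤ _ := integral_mono hind hint hle
  linarith

/-- **THE BUDGET OF A WINDOW AT HEIGHT `τ`** (prime side only, no measure, no hypothesis): for `a > 0`, `τ ∈ ℝ`,

  `weilWindowForm a (e^{−iτx}χ_0) ≤ 4(sinh²(a/2) + sin²(aτ))/(a(¼+τ²)) − K₀ + [Re ψ(¼+iτ/2) − Re ψ(¼)] + 5/a`
                                  `+ 2Σ_{log n<2a} Λ(n)n^{-1/2}(1 − log n/(2a))`

(closed form + pole bound + archimedean cost + `|cos| ≤ 1`). -/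
theorem weilWindowForm_modulated_le_budget (ha : 0 < a) (τ : ℝ) :
    weilWindowForm a (fun x ↦ cexp (I * ((-τ) * x : ℝ)) * chi a 0 x) ≤
      4 * (Real.sinh (a / 2) ^ 2 + Real.sin (τ * a) ^ 2) / (a * (1 / 4 + τ ^ 2)) -
        (Real.log (4 * π) + Real.eulerMascheroniConstant +
          2 * ∫ t in Ioi (0 : ℝ), (Real.exp (t / 2) - 1) / (2 * Real.sinh t)) +
        (reDigammaQuarter τ - reDigammaQuarter 0) + 5 / a +
        2 * (∑ n ∈ weilPrimeIndex a, (Λ n : ℝ) / Real.sqrt n * (1 - Real.log n / (2 * a))) := by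
  rw [weilWindowForm_modulated_chi_zero ha]
  have hcos : ∀ t : ℝ, Real.cos (-τ * t) = Real.cos (τ * t) := fun t ↦ by rw [neg_mul, Real.cos_neg]
  simp only [hcos]
  have hP : weilPoleForm (fun x ↦ cexp (I * ((-τ) * x : ℝ)) * chi a 0 x) ≤
      4 * (Real.sinh (a / 2) ^ 2 + Real.sin (τ * a) ^ 2) / (a * (1 / 4 + τ ^ 2)) := by
    have h' := weilPoleForm_modulated_chi_zero_le ha (-τ)
    rwa [neg_mul, Real.sin_neg, neg_sq, neg_sq] at h'
  have hc := integral_modulationCost_zero_le ha τ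
  have hs := neg_flatSum_le_cos_flatSum ha τ
  linarith

/-- **ONE `ζ`-RUNG BOUNDS THE SPECTRAL MASS AT EVERY HEIGHT.**  Let `a > 0` and let `μ` represent Weil's
form on the tests of `[-a, a]` (such `μ` exist iff `WeilPositivityOn a`; unconditionally for
`a ≤ 4023/5000`).  Then for every `τ ∈ ℝ`

  `2a·μ{τ} ≤ 4(sinh²(a/2) + sin²(aτ))/(a(¼+τ²)) − K₀ + [Re ψ(¼+iτ/2) − Re ψ(¼)] + 5/a + 2Σ_{log n<2a} Λ(n)n^{-1/2}(1 − log n/(2a))`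

— pole (`≍ e^a/(aτ²)`), archimedean weight at height `τ` (`≍ log|τ|`) and the prime budget of the window
(`≍ 4e^a/a`), divided by the window. -/
theorem two_mul_mul_zetaAtom_le_budget (ha : 0 < a) {μ : Measure ℝ}
    (hμ : ∀ g : ℝ → ℂ, IsWeilTest g → tsupport g ⊆ Icc (-a) a →
      Integrable (fun t : ℝ ↦ ‖weilMellin g (1 / 2 + t * I)‖ ^ 2) μ ∧
        weilQuadratic g = ((∫ t, ‖weilMellin g (1 / 2 + t * I)‖ ^ 2 ∂μ : ℝ) : ℂ)) (τ : ℝ) :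
    2 * a * μ.real {τ} ≤
      4 * (Real.sinh (a / 2) ^ 2 + Real.sin (τ * a) ^ 2) / (a * (1 / 4 + τ ^ 2)) -
        (Real.log (4 * π) + Real.eulerMascheroniConstant +
          2 * ∫ t in Ioi (0 : ℝ), (Real.exp (t / 2) - 1) / (2 * Real.sinh t)) +
        (reDigammaQuarter τ - reDigammaQuarter 0) + 5 / a +
        2 * (∑ n ∈ weilPrimeIndex a, (Λ n : ℝ) / Real.sqrt n * (1 - Real.log n / (2 * a))) := by
  have h := two_mul_mul_zetaAtom_le ha hμ τ
  have hb := weilWindowForm_modulated_le_budget ha τ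
  rw [weilWindowForm_modulated_chi_zero ha] at hb
  have hcos : ∀ t : ℝ, Real.cos (-τ * t) = Real.cos (τ * t) := fun t ↦ by rw [neg_mul, Real.cos_neg]
  simp only [hcos] at hb
  linarith

end Summit.Ventures.WeilGRH
-- Build note (weil-3 gen13, 2026-08-24): byte-identical re-land under lead ruling R14-3 (APPEND REMEDY) to trigger the hub build; p370519 accepted 2026-08-23T19:16Z.
end
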